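import Literature.NumberTheory.Rogawski1990.RankOneTorusRegularLocusDense   -- ★ p843437 F0P2-p01 (g10): §1∕§2 cone lemmas (`tendsto_conj_glDiagonal_two`, `conj_glDiagonal_normOne_mem_local∕_centralizer`, `isRegularElt_mul_conj_glDiagonal_of_not_isRegularElt`), brings ★ `galAdicCompletionMap` kit
import Literature.NumberTheory.Rogawski1990.RankOneTorusDepthContinuity     -- ★ p843453 F0P3a-p03 (g12) (b3): `eventually_valued_frameEntry_sub_lt_pow_of_not_isRegularElt` (hunr-free), `lt_of_pow_lt_pow_of_le_one`; brings ★ p843388 `valued_frameEntry_sub_ne_zero_le_one`, `eq_exp_neg_one_pow_toNat_neg_log`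
import HarnessLib

/-!
# The REGULAR LOCUS of an elliptic regular torus of `H_v = U(Φ₂) × U(Φ₁)` is DENSE at EVERY non-split place (ramified included)
# (Rogawski 1990, §3.6, Lemma 4.9.3; Labesse–Langlands 1979, §2)

Topic `NumberTheory/Rogawski1990`; namespace `Literature.NumberTheory.Rogawski1990`.  THEOREMS ONLY (no definition, no named fact, no instance,
no notation, no `sorry`).  Cell `pub/hodgecm-mathlib`, crux H413 = stmt-HodgeConjecture-24833, line «N6nsGerm» stub `stub_N6nsR1LL`, road «R1LL-tree»,
RAMIFIED branch «R1-ram» (architect A-p16 (g27) RULINGS A-14 (c), A-18 (c): brick R-5b = the three sockets of ★ L1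
`rankOneUnstable_core_inert_of_eventually` (`RankOneUnstableTransferInertCore`, F0P3-p01 (g13)) at a RAMIFIED non-split place; L1 carries NO unramified
hypothesis).  Hand: A-p12 (g19).  THIS FILE = socket `hdense` WITHOUT the unramified hypothesis.

WHY A NEW FILE.  ★ `dense_setOf_isRegularElt_centralizer` (F0P2-p01 (g10), `RankOneTorusRegularLocusDense` §3) is stated with
`(hunr : Algebra.IsUnramifiedIn (𝓞 L) v.asIdeal)`, used ONLY to produce the norm-one sequence `u_N → 1`, `u_N ≠ 1` through ★ `exists_normOne_seq` (p08 (g14)),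
whose valuation clause `|1 − u_N|_w = |ϖ_v|_w^N` is read through the UNRAMIFIED uniformizer.  At a ramified `w` a norm-one sequence with `u_N ≠ 1`, `u_N → 1`
exists just as well — `x_N := 1 + ϖ^N a₀` with ANY `σ_w`-fixed `ϖ`, `0 < |ϖ|_w < 1` (here `ϖ := π · σ_w π` for a uniformiser `π ∈ L` of `w`) and ANY `a₀`
moved by `σ_w` (here the CM generator `α`, `σ α = −α ≠ α`), `u_N := x_N ∕ σ_w x_N`: `σ_w(u_N) u_N = 1` (`σ_w² = 1`), `u_N = 1 ⟺ ϖ^N (a₀ − σ_w a₀) = 0 ⟺` false,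
`u_N → 1` — and F0P2-p01's §3 argument runs VERBATIM over it.  So the density holds at every place `v` of `L⁺` with ONE place of `L` above it.

WHAT IS PROVED (`L` CM, `v` a finite place of `L⁺`, `w ∣ v` with `c • w = w`; `H_v` on the ★ `cmDatum` carriers; binders of ★ L1):
* §1 `exists_normOne_seq_ne_one (w hw)` — `∃ u : ℕ → L_w, (∀ N, σ_w (u N) · u N = 1) ∧ (∀ N, 1 ≤ N → u N ≠ 1) ∧ u → 1` (no ramification hypothesis).
* §2 **`dense_setOf_isRegularElt_centralizer_nonsplit (hv) (t₀ P d ht₀ hP hd1)`** — `Dense {t ∈ Z(t₀) | t.1 regular}` at EVERY `v` with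
  `Subsingleton (PlacesOver L v)`; the `hdense` socket of ★ `rankOneUnstable_core_inert_of_eventually` for the ramified assembly R-5b (and a
  hypothesis-lighter replacement at inert `v`).
* §3 **`eventually_lt_depth_of_not_isRegularElt_nonsplit (w hw) (t₀ P d ht₀ hP hd1) (s) (hs) (M)`** (+ `_le_`) — the `hN` socket of the (β) LAYER 2a
  algebra WITHOUT the unramified hypothesis: at a singular `s ∈ Z(t₀)` the depth `N t := (−log v_w((τ₀ t − τ₁ t)_w)).toNat` exceeds every `M` eventually along
  the regular locus (twin of ★ F0P3a-p03 `eventually_lt_depth_of_not_isRegularElt (hunr)`, whose `hunr` only pins `v_w(ϖ_v) = exp(−1)`; here the comparison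
  runs against `exp(−1)` itself through ★ `eq_exp_neg_one_pow_toNat_neg_log`).
HONEST LABEL: HC_CM is proved only modulo the printed citations (2 remaining named inputs hLiu418, h413) until rung 0 closes; this file is unconditional
local algebra ∕ topology.

## References
* [Rogawski1990] J. D. Rogawski, *Automorphic Representations of Unitary Groups in Three Variables*, Ann. of Math. Stud. 123 (1990): §3.6 pp. 31–32,
  §4.9 Lemma 4.9.3 p. 56.
* [LabesseLanglands1979] J.-P. Labesse, R. P. Langlands, *L-indistinguishability for SL(2)*, Canad. J. Math. 31 (1979): §2.
* [BourbakiGT1] N. Bourbaki, *General Topology*, Ch. I §8.3, Ch. III §1.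
* [Serre1979] J.-P. Serre, *Local Fields* (1979), Ch. V §2 (Hilbert 90 for the norm-one torus: `u = x ∕ σx`).
-/

set_option autoImplicit false

noncomputable section

open Filter Topology NumberField IsDedekindDomain Polynomial Matrix
open scoped MatrixGroups

namespace Literature.NumberTheory.Rogawski1990

open Literature.NumberTheory.Automorphic Literature.NumberTheory.Automorphic.UnitaryGroup Literature.NumberTheory.GaloisRepresentations
open Literature.AlgebraicGeometry.ShimuraVarieties (unitaryGroup mem_unitaryGroup_iff)

section Helpers

/-- At a place with ONE prime of `L` above it, that prime is fixed by complex conjugation (local copy of ★ `smul_eq_of_subsingleton_placesOver`).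
[cite: CasselsFrohlichANT1967, Ch. VII Prop. 1.2 (ii)] -/
private theorem smul_eq_of_subsingleton_placesOver₁₂ (L : Type) [Field L] [NumberField L] [IsCMField L] {v : HeightOneSpectrum (𝓞 ↥(maximalRealSubfield L))}
    (hv : Subsingleton (PlacesOver L v)) (w : PlacesOver L v) :
    IsCMField.complexConj L • w.1 = w.1 := by
  have hmem : (IsCMField.complexConj L • w.1).under (𝓞 ↥(maximalRealSubfield L)) = v := by
    rw [HeightOneSpectrum.under_algEquiv_smul]; exact w.2
  exact congrArg Subtype.val (Subsingleton.elim (⟨IsCMField.complexConj L • w.1, hmem⟩ : PlacesOver L v) w)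

end Helpers

section Density

variable (L : Type) [Field L] [NumberField L] [IsCMField L] (v : HeightOneSpectrum (𝓞 ↥(maximalRealSubfield L)))
  (w : PlacesOver L v)

/-! ## §1 A norm-one sequence `u_N → 1`, `u_N ≠ 1` at ANY non-split place -/

/-- **A NORM-ONE SEQUENCE `u_N → 1` WITH `u_N ≠ 1`** at a non-split place `w ∣ v` (NO ramification hypothesis): with `π ∈ L` a uniformiser at `w`,
`ϖ := π · σ_w π` (`σ_w`-fixed, `0 < |ϖ|_w < 1`), `a₀ := α` the CM generator (`σ_w a₀ = −a₀ ≠ a₀`), `x_N := 1 + ϖ^N a₀` and `u_N := x_N · (σ_w x_N)⁻¹`: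
`σ_w(u_N) · u_N = 1` (`σ_w² = 1`), `u_N ≠ 1` for `N ≥ 1` (else `ϖ^N (a₀ − σ_w a₀) = 0`), and `u_N → 1` (`ϖ^N a₀ → 0`, `σ_w` and inversion continuous).
Twin of ★ `exists_normOne_seq` (p08 (g14), inert, with the sharper clause `|1 − u_N| = |ϖ_v|^N`). [cite: LabesseLanglands1979, §2] [cite: Serre1979, Ch. V §2 Prop. 3] -/
theorem exists_normOne_seq_ne_one (hw : IsCMField.complexConj L • w.1 = w.1) :
    ∃ u : ℕ → w.1.adicCompletion L,
      (∀ N, galAdicCompletionMap (L := L) (IsCMField.complexConj L) hw (u N) * u N = 1) ∧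
      (∀ N, 1 ≤ N → u N ≠ 1) ∧
      Tendsto u atTop (𝓝 1) := by
  classical
  have hc1 : IsCMField.complexConj L ≠ 1 := IsCMField.complexConj_ne_one L
  set σ := galAdicCompletionMap (L := L) (IsCMField.complexConj L) hw with hσdef
  have hσσ : ∀ x, σ (σ x) = x := fun x => galAdicCompletionMap_galAdicCompletionMap_of_smul_eq (IsCMField.complexConj L) w hc1 hw x
  have hσv : ∀ x, Valued.v (σ x) = Valued.v x := fun x => valued_galAdicCompletionMap (L := L) (IsCMField.complexConj L) hw x
  -- a `σ`-fixed element of valuation in `(0, 1)`: `ϖ := π · σ π`, `π ∈ L` a uniformiser at `w`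
  obtain ⟨π₀, hπ₀⟩ := w.1.valuation_exists_uniformizer L
  set ϖ : w.1.adicCompletion L := (π₀ : w.1.adicCompletion L) * σ (π₀ : w.1.adicCompletion L) with hϖdef
  have hπv : Valued.v (π₀ : w.1.adicCompletion L) = WithZero.exp (-1 : ℤ) := by
    rw [HeightOneSpectrum.valuedAdicCompletion_eq_valuation', hπ₀]
  have hπ1 : Valued.v (π₀ : w.1.adicCompletion L) < 1 := by
    rw [hπv, ← WithZero.exp_zero]; exact WithZero.exp_lt_exp.2 (by norm_num)
  have hπ0 : (π₀ : w.1.adicCompletion L) ≠ 0 := fun h => by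
    rw [h, map_zero] at hπv; exact WithZero.coe_ne_zero hπv.symm
  have hϖ1 : Valued.v ϖ < 1 := by
    rw [hϖdef, Valuation.map_mul, hσv]
    exact mul_lt_one_of_nonneg_of_lt_one_left zero_le hπ1 hπ1.le
  have hσϖ : σ ϖ = ϖ := by rw [hϖdef, map_mul, hσσ, mul_comm]
  have hϖ0 : ϖ ≠ 0 := by
    rw [hϖdef]
    refine mul_ne_zero hπ0 fun h => hπ0 ?_
    have := congrArg σ h; rwa [hσσ, map_zero] at this
  -- `a₀` moved by `σ`: the CM generator `α`, `σ α = −α`, `α ≠ 0`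
  obtain ⟨α, hα0, hcα, -⟩ := cmQuadraticGenerator_spec L
  set a₀ : w.1.adicCompletion L := algebraMap L (w.1.adicCompletion L) α with ha₀def
  have hσa₀ : σ a₀ = -a₀ := by
    rw [ha₀def, hσdef, galAdicCompletionMap_complexConj_algebraMap L v w hw α, cmConjRingHom_apply, hcα, map_neg]
  have ha₀0 : a₀ ≠ 0 := fun h0 => hα0 ((algebraMap L (w.1.adicCompletion L)).injective (by rw [← ha₀def, h0, map_zero]))
  haveI : CharZero (w.1.adicCompletion L) := charZero_of_injective_algebraMap (algebraMap L (w.1.adicCompletion L)).injective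
  have hmoved : σ a₀ ≠ a₀ := by
    rw [hσa₀]
    intro h
    have h2 : a₀ + a₀ = 0 := by linear_combination -h
    exact ha₀0 (add_self_eq_zero.1 h2)
  -- the elements `x_N`, `σ x_N`
  have hσx : ∀ N, σ (1 + ϖ ^ N * a₀) = 1 + ϖ ^ N * σ a₀ := fun N => by rw [map_add, map_one, map_mul, map_pow, hσϖ]
  -- `x_N ≠ 0` and `σ x_N ≠ 0` for every `N`: if `1 + ϖ^N a₀ = 0` then applying `σ` gives `1 + ϖ^N σ a₀ = 0`, whence `ϖ^N (a₀ − σ a₀) = 0`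
  have hxne : ∀ N, 1 + ϖ ^ N * a₀ ≠ 0 := fun N h => by
    have h' : 1 + ϖ ^ N * σ a₀ = 0 := by rw [← hσx N, h, map_zero]
    have hd : ϖ ^ N * (a₀ - σ a₀) = 0 := by linear_combination h - h'
    rcases mul_eq_zero.1 hd with hp | hq
    · exact pow_ne_zero N hϖ0 hp
    · exact hmoved (sub_eq_zero.1 hq).symm
  have hσxne : ∀ N, σ (1 + ϖ ^ N * a₀) ≠ 0 := fun N h => hxne N (by
    have := congrArg σ h; rwa [hσσ, map_zero] at this)
  refine ⟨fun N => (1 + ϖ ^ N * a₀) * (σ (1 + ϖ ^ N * a₀))⁻¹, fun N => ?_, fun N hN => ?_, ?_⟩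
  · -- norm one
    have h1 := hxne N
    have h2 := hσxne N
    rw [map_mul, map_inv₀, hσσ]
    field_simp
  · -- `u_N ≠ 1`: else `x_N = σ x_N`, i.e. `ϖ^N (a₀ − σ a₀) = 0`
    intro hu
    have h2 := hσxne N
    have heq : 1 + ϖ ^ N * a₀ = σ (1 + ϖ ^ N * a₀) := by
      have := congrArg (fun y => y * σ (1 + ϖ ^ N * a₀)) hu
      simpa only [inv_mul_cancel_right₀ h2, one_mul] using this
    rw [hσx N] at heq
    have hd : ϖ ^ N * (a₀ - σ a₀) = 0 := by linear_combination heq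
    rcases mul_eq_zero.1 hd with hp | hq
    · exact pow_ne_zero N hϖ0 hp
    · exact hmoved (sub_eq_zero.1 hq).symm
  · -- the limit: `ϖ^N a₀ → 0`, `σ` continuous, inversion continuous at `1`
    have hpow : Tendsto (fun N : ℕ => ϖ ^ N * a₀) atTop (𝓝 0) := by
      simpa only [zero_mul] using (Valued.tendsto_zero_pow_of_v_lt_one hϖ1).mul_const a₀
    have hx : Tendsto (fun N : ℕ => 1 + ϖ ^ N * a₀) atTop (𝓝 1) := by
      simpa only [add_zero] using tendsto_const_nhds.add hpow
    have hσc : Continuous σ := continuous_galAdicCompletionMap (L := L) (IsCMField.complexConj L) hw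
    have hσx' : Tendsto (fun N : ℕ => σ (1 + ϖ ^ N * a₀)) atTop (𝓝 1) := by
      have h := (hσc.tendsto 1).comp hx
      rw [map_one] at h
      exact h
    have hinv : Tendsto (fun N : ℕ => (σ (1 + ϖ ^ N * a₀))⁻¹) atTop (𝓝 1) := by
      simpa only [inv_one] using hσx'.inv₀ one_ne_zero
    simpa only [mul_one] using hx.mul hinv

/-! ## §2 The regular locus is dense in the torus `Z(t₀)` — every non-split place -/

/-- **THE REGULAR LOCUS IS DENSE IN AN ELLIPTIC REGULAR TORUS OF `H_v`, AT EVERY NON-SPLIT PLACE** (socket `hdense` of ★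
`rankOneUnstable_core_inert_of_eventually`, which carries NO unramified hypothesis — so this is the `hdense` of the RAMIFIED assembly R-5b as well).
For `t₀ ∈ H_v` with `t₀.1` regular and an eigenframe `t₀.1·P = P·diag d`, `σ(dᵢ) dᵢ = 1`, the set `{t ∈ Z(t₀) | t.1 regular}` is dense in `Z(t₀)`:
a singular `x ∈ Z(t₀)` is the limit of the REGULAR `x · (P diag(u_N, 1) P⁻¹, 1) ∈ Z(t₀)` along the norm-one sequence `u_N → 1`, `u_N ≠ 1` of
`exists_normOne_seq_ne_one` (read in `L_v = ∏_{w' ∣ v} L_{w'} ≃ L_w`, one place above `v`); F0P2-p01's ★ §3 argument verbatim.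
[cite: Rogawski1990, §3.6 pp. 31–32; §4.9 Lemma 4.9.3 p. 56] [cite: LabesseLanglands1979, §2] [cite: BourbakiGT1, Ch. I §8.3] -/
theorem dense_setOf_isRegularElt_centralizer_nonsplit (hv : Subsingleton (PlacesOver L v))
    (t₀ : ((cmDatum L 2 (Matrix.of fun i j : Fin 2 => if i.val + j.val + 1 = 2 then (1 : L) else 0)).Local v × (cmDatum L 1 (Matrix.of fun i j : Fin 1 => if i.val + j.val + 1 = 1 then (1 : L) else 0)).Local v)) (P : GL (Fin 2) (LocalRing L v)) (d : Fin 2 → (LocalRing L v)) (ht₀ : IsRegularElt (t₀.1.val : GL (Fin 2) (LocalRing L v)))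
    (hP : (t₀.1.val.val : Matrix (Fin 2) (Fin 2) (LocalRing L v)) * P.val = P.val * Matrix.diagonal d) (hd1 : ∀ i, conjLocal L (IsCMField.complexConj L) v (d i) * d i = 1) :
    Dense {t : ↥(Subgroup.centralizer ({t₀} : Set ((cmDatum L 2 (Matrix.of fun i j : Fin 2 => if i.val + j.val + 1 = 2 then (1 : L) else 0)).Local v × (cmDatum L 1 (Matrix.of fun i j : Fin 1 => if i.val + j.val + 1 = 1 then (1 : L) else 0)).Local v))) | IsRegularElt ((t : ((cmDatum L 2 (Matrix.of fun i j : Fin 2 => if i.val + j.val + 1 = 2 then (1 : L) else 0)).Local v × (cmDatum L 1 (Matrix.of fun i j : Fin 1 => if i.val + j.val + 1 = 1 then (1 : L) else 0)).Local v)).1.val : GL (Fin 2) (LocalRing L v))} := by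
  classical
  obtain ⟨w⟩ := PlacesOver.nonempty L v
  have hw : IsCMField.complexConj L • w.1 = w.1 := smul_eq_of_subsingleton_placesOver₁₂ L hv w
  have hc1 : IsCMField.complexConj L ≠ 1 := IsCMField.complexConj_ne_one L
  haveI : Subsingleton (PlacesOver L v) := hv
  letI : Unique (PlacesOver L v) := uniqueOfSubsingleton w
  -- the evaluation isomorphism `π : L_v ≃+* L_w` and the norm-one sequence of `exists_normOne_seq_ne_one`, read in `L_v`
  let π : LocalRing L v ≃+* w.1.adicCompletion L := RingEquiv.piUnique fun w' : PlacesOver L v => w'.1.adicCompletion L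
  have hπ : ∀ y : LocalRing L v, π y = y w := fun _ => rfl
  have hσπ : ∀ y : LocalRing L v, π (conjLocal L (IsCMField.complexConj L) v y) = galAdicCompletionMap (L := L) (IsCMField.complexConj L) hw (π y) :=
    fun y => by rw [hπ, hπ]; exact conjLocal_apply_eq_of_smul_eq (IsCMField.complexConj L) hc1 v w hw y
  have hπsc : Continuous π.symm := by
    have h := (Homeomorph.piUnique fun w' : PlacesOver L v => w'.1.adicCompletion L).symm.continuous
    exact h
  obtain ⟨useq, hu1, hune, hulim⟩ := exists_normOne_seq_ne_one L v w hw
  have hz1 : ∀ N, conjLocal L (IsCMField.complexConj L) v (π.symm (useq N)) * π.symm (useq N) = 1 := fun N => by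
    apply π.injective
    rw [map_mul, hσπ, RingEquiv.apply_symm_apply, map_one]
    exact hu1 N
  have hz1' : ∀ N, π.symm (useq N) * conjLocal L (IsCMField.complexConj L) v (π.symm (useq N)) = 1 := fun N => by
    rw [mul_comm]; exact hz1 N
  have hzlim : Tendsto (fun N => π.symm (useq N)) atTop (𝓝 1) := by
    have h := (hπsc.tendsto 1).comp hulim
    rw [map_one] at h
    exact h
  have hσzlim : Tendsto (fun N => conjLocal L (IsCMField.complexConj L) v (π.symm (useq N))) atTop (𝓝 1) := by
    have hσu : ∀ N, galAdicCompletionMap (L := L) (IsCMField.complexConj L) hw (useq N) = (useq N)⁻¹ := fun N =>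
      eq_inv_of_mul_eq_one_left (hu1 N)
    have hinv : Tendsto (fun N => (useq N)⁻¹) atTop (𝓝 1) := by simpa using hulim.inv₀ one_ne_zero
    have h := (hπsc.tendsto 1).comp hinv
    rw [map_one] at h
    refine h.congr fun N => ?_
    show π.symm ((useq N)⁻¹) = conjLocal L (IsCMField.complexConj L) v (π.symm (useq N))
    apply π.injective
    rw [RingEquiv.apply_symm_apply, hσπ, RingEquiv.apply_symm_apply, hσu]
  have hzne : ∀ N, 1 ≤ N → π.symm (useq N) ≠ 1 := fun N hN h => by
    have hu : useq N = 1 := by rw [← π.apply_symm_apply (useq N), h, map_one]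
    exact hune N hN hu
  -- the curve `N ↦ (P diag(z_N, 1) P⁻¹, 1) ∈ Z(t₀)` tends to `1`
  have hS := tendsto_conj_glDiagonal_two P hz1' hz1 hzlim hσzlim
  have hc : Tendsto (fun N => (⟨(((⟨P * glDiagonal 2 (LocalRing L v)
        ![(⟨π.symm (useq N), conjLocal L (IsCMField.complexConj L) v (π.symm (useq N)), hz1' N, hz1 N⟩ : (LocalRing L v)ˣ), 1] * P⁻¹,
        conj_glDiagonal_normOne_mem_local L v w hw t₀ P d ht₀ hP hd1 (hz1 N) (hz1' N)⟩ : ((cmDatum L 2 (Matrix.of fun i j : Fin 2 => if i.val + j.val + 1 = 2 then (1 : L) else 0)).Local v)), (1 : ((cmDatum L 1 (Matrix.of fun i j : Fin 1 => if i.val + j.val + 1 = 1 then (1 : L) else 0)).Local v))) : ((cmDatum L 2 (Matrix.of fun i j : Fin 2 => if i.val + j.val + 1 = 2 then (1 : L) else 0)).Local v × (cmDatum L 1 (Matrix.of fun i j : Fin 1 => if i.val + j.val + 1 = 1 then (1 : L) else 0)).Local v)),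
        conj_glDiagonal_normOne_mem_centralizer L v w hw t₀ P d ht₀ hP hd1 (hz1 N) (hz1' N)⟩ : ↥(Subgroup.centralizer ({t₀} : Set ((cmDatum L 2 (Matrix.of fun i j : Fin 2 => if i.val + j.val + 1 = 2 then (1 : L) else 0)).Local v × (cmDatum L 1 (Matrix.of fun i j : Fin 1 => if i.val + j.val + 1 = 1 then (1 : L) else 0)).Local v))))) atTop (𝓝 1) := by
    rw [tendsto_subtype_rng]
    show Tendsto (fun N => (((⟨P * glDiagonal 2 (LocalRing L v)
        ![(⟨π.symm (useq N), conjLocal L (IsCMField.complexConj L) v (π.symm (useq N)), hz1' N, hz1 N⟩ : (LocalRing L v)ˣ), 1] * P⁻¹,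
        conj_glDiagonal_normOne_mem_local L v w hw t₀ P d ht₀ hP hd1 (hz1 N) (hz1' N)⟩ : ((cmDatum L 2 (Matrix.of fun i j : Fin 2 => if i.val + j.val + 1 = 2 then (1 : L) else 0)).Local v)), (1 : ((cmDatum L 1 (Matrix.of fun i j : Fin 1 => if i.val + j.val + 1 = 1 then (1 : L) else 0)).Local v))) : ((cmDatum L 2 (Matrix.of fun i j : Fin 2 => if i.val + j.val + 1 = 2 then (1 : L) else 0)).Local v × (cmDatum L 1 (Matrix.of fun i j : Fin 1 => if i.val + j.val + 1 = 1 then (1 : L) else 0)).Local v))) atTop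
      (𝓝 ((1 : ((cmDatum L 2 (Matrix.of fun i j : Fin 2 => if i.val + j.val + 1 = 2 then (1 : L) else 0)).Local v)), (1 : ((cmDatum L 1 (Matrix.of fun i j : Fin 1 => if i.val + j.val + 1 = 1 then (1 : L) else 0)).Local v))))
    refine Filter.Tendsto.prodMk_nhds ?_ tendsto_const_nhds
    show Tendsto (fun N => (⟨P * glDiagonal 2 (LocalRing L v)
        ![(⟨π.symm (useq N), conjLocal L (IsCMField.complexConj L) v (π.symm (useq N)), hz1' N, hz1 N⟩ : (LocalRing L v)ˣ), 1] * P⁻¹,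
        conj_glDiagonal_normOne_mem_local L v w hw t₀ P d ht₀ hP hd1 (hz1 N) (hz1' N)⟩ : ↥(«local» L (IsCMField.complexConj L) 2 (Matrix.of fun i j : Fin 2 => if i.val + j.val + 1 = 2 then (1 : L) else 0) v))) atTop (𝓝 (1 : ↥(«local» L (IsCMField.complexConj L) 2 (Matrix.of fun i j : Fin 2 => if i.val + j.val + 1 = 2 then (1 : L) else 0) v)))
    exact tendsto_subtype_rng.2 hS
  -- density: a regular `x` is in the set; a singular `x` is the limit of the regular `x · c_N`
  intro x
  by_cases hx : IsRegularElt (((x : ↥(Subgroup.centralizer ({t₀} : Set ((cmDatum L 2 (Matrix.of fun i j : Fin 2 => if i.val + j.val + 1 = 2 then (1 : L) else 0)).Local v × (cmDatum L 1 (Matrix.of fun i j : Fin 1 => if i.val + j.val + 1 = 1 then (1 : L) else 0)).Local v)))) : ((cmDatum L 2 (Matrix.of fun i j : Fin 2 => if i.val + j.val + 1 = 2 then (1 : L) else 0)).Local v × (cmDatum L 1 (Matrix.of fun i j : Fin 1 => if i.val + j.val + 1 = 1 then (1 : L) else 0)).Local v)).1.val : GL (Fin 2) (LocalRing L v))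
  · exact subset_closure hx
  have hxc := (tendsto_const_nhds (x := x)).mul hc
  rw [mul_one] at hxc
  refine mem_closure_of_tendsto hxc (Filter.eventually_atTop.2 ⟨1, fun N hN => ?_⟩)
  exact isRegularElt_mul_conj_glDiagonal_of_not_isRegularElt L v w hw t₀ P d ht₀ hP hd1 (hz1 N) (hz1' N) (hzne N hN) x hx

/-! ## §3 The depth tends to infinity at the singular points — every non-split place -/

/-- **THE `hN` BINDER AT EVERY NON-SPLIT PLACE: at a singular point of the torus the depth `N t := (−log v_w((τ₀ t − τ₁ t)_w)).toNat` exceeds every `M`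
eventually along the regular locus.**  No ramification hypothesis: eventually `v_w((τ₀ t − τ₁ t)_w) < v_w(π)^M = exp(−1)^M` for a uniformiser `π ∈ L` of `w`
(★ `eventually_valued_frameEntry_sub_lt_pow_of_not_isRegularElt`), while at a regular `t` the value is `exp(−1)^{N t}` (non-zero and `≤ 1`, ★
`valued_frameEntry_sub_ne_zero_le_one`, ★ `eq_exp_neg_one_pow_toNat_neg_log`), so `M < N t`.  Twin of ★ `eventually_lt_depth_of_not_isRegularElt` (inert).
[cite: Rogawski1990, §4.9 Lemma 4.9.3 (4.9.2) p. 56] [cite: LabesseLanglands1979, §2] -/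
theorem eventually_lt_depth_of_not_isRegularElt_nonsplit (hw : IsCMField.complexConj L • w.1 = w.1)
    (t₀ : ((cmDatum L 2 (Matrix.of fun i j : Fin 2 => if i.val + j.val + 1 = 2 then (1 : L) else 0)).Local v × (cmDatum L 1 (Matrix.of fun i j : Fin 1 => if i.val + j.val + 1 = 1 then (1 : L) else 0)).Local v)) (P : GL (Fin 2) (LocalRing L v)) (d : Fin 2 → (LocalRing L v)) (ht₀ : IsRegularElt (t₀.1.val : GL (Fin 2) (LocalRing L v)))
    (hP : (t₀.1.val.val : Matrix (Fin 2) (Fin 2) (LocalRing L v)) * P.val = P.val * Matrix.diagonal d) (hd1 : ∀ i, conjLocal L (IsCMField.complexConj L) v (d i) * d i = 1)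
    (s : ↥(Subgroup.centralizer ({t₀} : Set ((cmDatum L 2 (Matrix.of fun i j : Fin 2 => if i.val + j.val + 1 = 2 then (1 : L) else 0)).Local v × (cmDatum L 1 (Matrix.of fun i j : Fin 1 => if i.val + j.val + 1 = 1 then (1 : L) else 0)).Local v))))
    (hs : ¬ IsRegularElt ((s : ((cmDatum L 2 (Matrix.of fun i j : Fin 2 => if i.val + j.val + 1 = 2 then (1 : L) else 0)).Local v × (cmDatum L 1 (Matrix.of fun i j : Fin 1 => if i.val + j.val + 1 = 1 then (1 : L) else 0)).Local v)).1.val : GL (Fin 2) (LocalRing L v))) (M : ℕ) :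
    ∀ᶠ (t : ↥(Subgroup.centralizer ({t₀} : Set ((cmDatum L 2 (Matrix.of fun i j : Fin 2 => if i.val + j.val + 1 = 2 then (1 : L) else 0)).Local v × (cmDatum L 1 (Matrix.of fun i j : Fin 1 => if i.val + j.val + 1 = 1 then (1 : L) else 0)).Local v)))) in 𝓝 s, t ∈ {t : ↥(Subgroup.centralizer ({t₀} : Set ((cmDatum L 2 (Matrix.of fun i j : Fin 2 => if i.val + j.val + 1 = 2 then (1 : L) else 0)).Local v × (cmDatum L 1 (Matrix.of fun i j : Fin 1 => if i.val + j.val + 1 = 1 then (1 : L) else 0)).Local v))) | IsRegularElt ((t : ((cmDatum L 2 (Matrix.of fun i j : Fin 2 => if i.val + j.val + 1 = 2 then (1 : L) else 0)).Local v × (cmDatum L 1 (Matrix.of fun i j : Fin 1 => if i.val + j.val + 1 = 1 then (1 : L) else 0)).Local v)).1.val : GL (Fin 2) (LocalRing L v))} →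
      M < (-WithZero.log (Valued.v ((((P⁻¹).val * ((t : ((cmDatum L 2 (Matrix.of fun i j : Fin 2 => if i.val + j.val + 1 = 2 then (1 : L) else 0)).Local v × (cmDatum L 1 (Matrix.of fun i j : Fin 1 => if i.val + j.val + 1 = 1 then (1 : L) else 0)).Local v)).1.val.val : Matrix (Fin 2) (Fin 2) (LocalRing L v)) * P.val) 0 0 - ((P⁻¹).val * ((t : ((cmDatum L 2 (Matrix.of fun i j : Fin 2 => if i.val + j.val + 1 = 2 then (1 : L) else 0)).Local v × (cmDatum L 1 (Matrix.of fun i j : Fin 1 => if i.val + j.val + 1 = 1 then (1 : L) else 0)).Local v)).1.val.val : Matrix (Fin 2) (Fin 2) (LocalRing L v)) * P.val) 1 1) w))).toNat := by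
  -- a uniformiser of `L_w` coming from `L`
  obtain ⟨π₀, hπ₀⟩ := w.1.valuation_exists_uniformizer L
  have hπv : Valued.v (π₀ : w.1.adicCompletion L) = WithZero.exp (-1 : ℤ) := by
    rw [HeightOneSpectrum.valuedAdicCompletion_eq_valuation', hπ₀]
  have hπne : (π₀ : w.1.adicCompletion L) ≠ 0 := fun h => by
    rw [h, map_zero] at hπv; exact WithZero.coe_ne_zero hπv.symm
  have he1 : WithZero.exp (-1 : ℤ) ≤ (1 : WithZero (Multiplicative ℤ)) := by
    rw [← WithZero.exp_zero, WithZero.exp_le_exp]; decide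
  filter_upwards [eventually_valued_frameEntry_sub_lt_pow_of_not_isRegularElt L v w hw t₀ P d ht₀ hP hd1 s hs _ hπne M] with t ht hreg
  obtain ⟨h0, h1⟩ := valued_frameEntry_sub_ne_zero_le_one L v w hw t₀ P d ht₀ hP hd1 (t : ((cmDatum L 2 (Matrix.of fun i j : Fin 2 => if i.val + j.val + 1 = 2 then (1 : L) else 0)).Local v × (cmDatum L 1 (Matrix.of fun i j : Fin 1 => if i.val + j.val + 1 = 1 then (1 : L) else 0)).Local v)) t.2 hreg
  rw [hπv] at ht
  rw [eq_exp_neg_one_pow_toNat_neg_log h0 h1] at ht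
  exact lt_of_pow_lt_pow_of_le_one he1 ht

/-- The `M ≤ N t` form of the `hN` binder at every non-split place (the literal shape of ★ `forall_exists_eventually_mul_eq_const_of_depthExpansion`'s `hN`).
[cite: Rogawski1990, §4.9 Lemma 4.9.3 (4.9.2) p. 56] -/
theorem eventually_le_depth_of_not_isRegularElt_nonsplit (hw : IsCMField.complexConj L • w.1 = w.1)
    (t₀ : ((cmDatum L 2 (Matrix.of fun i j : Fin 2 => if i.val + j.val + 1 = 2 then (1 : L) else 0)).Local v × (cmDatum L 1 (Matrix.of fun i j : Fin 1 => if i.val + j.val + 1 = 1 then (1 : L) else 0)).Local v)) (P : GL (Fin 2) (LocalRing L v)) (d : Fin 2 → (LocalRing L v)) (ht₀ : IsRegularElt (t₀.1.val : GL (Fin 2) (LocalRing L v)))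
    (hP : (t₀.1.val.val : Matrix (Fin 2) (Fin 2) (LocalRing L v)) * P.val = P.val * Matrix.diagonal d) (hd1 : ∀ i, conjLocal L (IsCMField.complexConj L) v (d i) * d i = 1)
    (s : ↥(Subgroup.centralizer ({t₀} : Set ((cmDatum L 2 (Matrix.of fun i j : Fin 2 => if i.val + j.val + 1 = 2 then (1 : L) else 0)).Local v × (cmDatum L 1 (Matrix.of fun i j : Fin 1 => if i.val + j.val + 1 = 1 then (1 : L) else 0)).Local v))))
    (hs : ¬ IsRegularElt ((s : ((cmDatum L 2 (Matrix.of fun i j : Fin 2 => if i.val + j.val + 1 = 2 then (1 : L) else 0)).Local v × (cmDatum L 1 (Matrix.of fun i j : Fin 1 => if i.val + j.val + 1 = 1 then (1 : L) else 0)).Local v)).1.val : GL (Fin 2) (LocalRing L v))) (M : ℕ) :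
    ∀ᶠ (t : ↥(Subgroup.centralizer ({t₀} : Set ((cmDatum L 2 (Matrix.of fun i j : Fin 2 => if i.val + j.val + 1 = 2 then (1 : L) else 0)).Local v × (cmDatum L 1 (Matrix.of fun i j : Fin 1 => if i.val + j.val + 1 = 1 then (1 : L) else 0)).Local v)))) in 𝓝 s, t ∈ {t : ↥(Subgroup.centralizer ({t₀} : Set ((cmDatum L 2 (Matrix.of fun i j : Fin 2 => if i.val + j.val + 1 = 2 then (1 : L) else 0)).Local v × (cmDatum L 1 (Matrix.of fun i j : Fin 1 => if i.val + j.val + 1 = 1 then (1 : L) else 0)).Local v))) | IsRegularElt ((t : ((cmDatum L 2 (Matrix.of fun i j : Fin 2 => if i.val + j.val + 1 = 2 then (1 : L) else 0)).Local v × (cmDatum L 1 (Matrix.of fun i j : Fin 1 => if i.val + j.val + 1 = 1 then (1 : L) else 0)).Local v)).1.val : GL (Fin 2) (LocalRing L v))} →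
      M ≤ (-WithZero.log (Valued.v ((((P⁻¹).val * ((t : ((cmDatum L 2 (Matrix.of fun i j : Fin 2 => if i.val + j.val + 1 = 2 then (1 : L) else 0)).Local v × (cmDatum L 1 (Matrix.of fun i j : Fin 1 => if i.val + j.val + 1 = 1 then (1 : L) else 0)).Local v)).1.val.val : Matrix (Fin 2) (Fin 2) (LocalRing L v)) * P.val) 0 0 - ((P⁻¹).val * ((t : ((cmDatum L 2 (Matrix.of fun i j : Fin 2 => if i.val + j.val + 1 = 2 then (1 : L) else 0)).Local v × (cmDatum L 1 (Matrix.of fun i j : Fin 1 => if i.val + j.val + 1 = 1 then (1 : L) else 0)).Local v)).1.val.val : Matrix (Fin 2) (Fin 2) (LocalRing L v)) * P.val) 1 1) w))).toNat :=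
  (eventually_lt_depth_of_not_isRegularElt_nonsplit L v w hw t₀ P d ht₀ hP hd1 s hs M).mono fun _ ht hreg => (ht hreg).le

end Density

end Literature.NumberTheory.Rogawski1990

end
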